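/-
Copyright (c) 2026 the pub-hodgecm-mathlib formalisation cell (harness21).  Prover seat hodgecm-mathlib-LH4-p12 (g0): line LH4 «(D-RAM) FOUR-FRAME», TIER-2 PAYER of
the TIER-0 stub `stub_pieceProps : PiecePropsWild mstarFn gselStar` of `Cruxes/H413/Lines/F0_P3c_DyRamFourFrame.lean` BY NAME (heir LEAD F0P3a-plan (g19) RULING
(R-15) «tier-0 pay-down pattern», dealer LH4-plan (g10) WORD #25 (B) «PAYER-T0-PP»).  2026-09-03.
-/
import Summits.HodgeConjecture.HodgeConjecture.Theorems.F0P3cDyRamFourFramePieces      -- ★ DEFS №3 (p854653): `gselStar = ![1_K, f_{T+}, f_{T−}, f_reg]`, `mstarFn`, `PiecePropsWild`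
import Summits.HodgeConjecture.HodgeConjecture.Theorems.F0P3cDyRamPiecePropsUnit0        -- ★ p854783 (F0P3-p01 (g30)): `piecePropsWild_unit0` (the `1_K` row)
import Summits.HodgeConjecture.HodgeConjecture.Theorems.F0P3cDyRamPiecePropsProfiles     -- ★ p854832 (B-p08 (g41)): `piecePropsWild_transvPlus ∕ _transvMinus ∕ _reg` (the three profile rows)
import HarnessLib

/-!
# Crux `H413`, line LH4 «(D-RAM) FOUR-FRAME» road — TIER 2: the piece properties of the WHOLE explicit selector `gselStar`,
# `PiecePropsWild mstarFn gselStar` (pays TIER-0 `stub_pieceProps` BY NAME)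

Cell `hodgecm-mathlib` (D-0151), FLOOR 0, crux item H413 = `stmt-HodgeConjecture-24833`, route of record `HCCMUnconditional`; squad F0∕P3c∕LH4 (req620 Track A);
tier-0 line module `Cruxes/H413/Lines/F0_P3c_DyRamFourFrame.lean` (b2df461498609bc0) stub `stub_pieceProps : PiecePropsWild mstarFn gselStar`.  Per the heir LEAD's
RULING (R-15) there is NO `Lines → Lines` import in Track A: a tier-0 stub is paid by a ★ `Theorems/` term whose TEMPLATE is the unit module's sorry-free export —
here `U4_Rows.piecePropsWild_of` (the `k = 4` gluing, `fin_cases` on `gselStar = ![1_K, f_{T+}, f_{T−}, f_reg]`) RE-PROVED over the four ★ per-piece heads.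
THEOREMS ONLY (no `def`, no instance, no notation, no `sorry`, default heartbeats); imports ★ only; lane `--supports stmt-HodgeConjecture-24833` (count-neutral).

WHAT IS PROVED.  `piecePropsWild_gselStar : PiecePropsWild mstarFn gselStar` — the tier-0 stub's statement TOKEN FOR TOKEN: at every wild ramified non-split place
`w ∣ v` (binders `hw`, `_he`, `_h2`, uniformiser `ϖ` with `|ϖ| = exp(−1)`) and for every `j : Fin 4`, the piece `gselStar j` is (1) `IsLocSmooth`, (2) supported in
`K = cmLocalIntegralLevel L 3 Φ₃ v`, (3) `Ad K`-invariant and (4) left-invariant under the level-`mstarFn L v w` congruence set — by cases on `j`: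
`j = 0` (`1_K`) ★ p854783 `piecePropsWild_unit0`; `j = 1, 2, 3` (`f_{T+}, f_{T−}, f_reg`) ★ p854832 `piecePropsWild_transvPlus ∕ _transvMinus ∕ _reg` — each of those
heads is the same four-clause statement for the constant one-piece selector `fun _ : Fin 1 => piece`, read at its index `0`.

HONEST LABEL.  Count-neutral; the verdict of record for (D-RAM) stays PRINT [LanglandsShelstad1989 Thm. p. 484 ∕ Rogawski1990 Prop. 4.9.1 (a)] ∕ XL; `HC_CM` is proved only
modulo the 7 printed citations (2 remaining: hLiu418 = `stmt-HodgeConjecture-24832`, h413 = `stmt-HodgeConjecture-24833`) until rung 0 closes.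

## References
* [Rogawski1990] J. D. Rogawski, *Automorphic Representations of Unitary Groups in Three Variables*, Ann. of Math. Stud. 123 (1990), §1.6 p. 6, §4.9 Prop. 4.9.1 p. 55
  (locally constant compactly supported test functions on `U(3)`; the unit of the Hecke algebra).
* [BernsteinZelevinsky1976] I. N. Bernstein, A. V. Zelevinsky, *Representations of the group GL(n,F) where F is a non-archimedean local field*, Russian Math.
  Surveys 31:3 (1976), §1.1 (the space `C_c^∞` of a totally disconnected group).
-/

noncomputable section

namespace Summit.HodgeConjecture.HodgeConjecture.Cruxes.H413.F0P3cDyRamPiecePropsGselStar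

open MeasureTheory Measure NumberField IsDedekindDomain Topology Filter
open Literature.NumberTheory.Automorphic Literature.NumberTheory.Automorphic.UnitaryGroup Literature.NumberTheory.Automorphic.IntegralReduction
open Literature.NumberTheory.Rogawski1990 Literature.NumberTheory.GaloisRepresentations
open Literature.NumberTheory.Automorphic.UnitaryThreeFourFrame
open Summit.HodgeConjecture.HodgeConjecture.Cruxes.H413.F0P3cDyRamFourFramePieces
open Summit.HodgeConjecture.HodgeConjecture.Cruxes.H413.F0P3cDyRamPiecePropsUnit0
open Summit.HodgeConjecture.HodgeConjecture.Cruxes.H413.F0P3cDyRamPiecePropsProfiles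
open scoped Matrix MatrixGroups Classical

/-- **PAYMENT OF TIER-0 `stub_pieceProps`**: the four explicit pieces `gselStar = ![1_K, f_{T+}, f_{T−}, f_reg]` are smooth, `K`-supported, `Ad K`-invariant and
left-invariant under the level-`m*` congruence set at every wild ramified non-split place — the `k = 4` gluing (`fin_cases j`) of the four ★ per-piece rows
★ p854783 `piecePropsWild_unit0` and ★ p854832 `piecePropsWild_transvPlus ∕ _transvMinus ∕ _reg`, each read at the index `0` of its one-piece selector.
[cite: Rogawski1990, §1.6 p. 6] [cite: BernsteinZelevinsky1976, §1.1] -/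
theorem piecePropsWild_gselStar : PiecePropsWild mstarFn gselStar := by
  intro L _ _ _ v w hw he h2 ϖ hϖ _ _ _ _ j
  fin_cases j
  · exact piecePropsWild_unit0 L w hw he h2 ϖ hϖ 0
  · exact piecePropsWild_transvPlus L w hw he h2 ϖ hϖ 0
  · exact piecePropsWild_transvMinus L w hw he h2 ϖ hϖ 0
  · exact piecePropsWild_reg L w hw he h2 ϖ hϖ 0

end Summit.HodgeConjecture.HodgeConjecture.Cruxes.H413.F0P3cDyRamPiecePropsGselStar

end
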